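import Mathlib.Analysis.SpecialFunctions.Trigonometric.EulerSineProd
import Mathlib.Analysis.PSeries
import Mathlib.Tactic
import HarnessLib

/-!
# Zagier's binomial–sine lemma (Zagier 2012, Lemma 1)

D. Zagier, *Evaluation of the multiple zeta values ζ(2,…,2,3,2,…,2)*, Ann. of Math. 175 (2012),
977–1000, doi:10.4007/annals.2012.175.2.11 — **Lemma 1** (p. 988): for `k ∈ ℕ` and `x ∈ ℂ`, the
function

  `f_k(x) = ∑_{m ≥ k} (-1)^{m-k} (k/m) C(m+x, 2m) C(2m, m-k)`

is given by `f_k(x) = 1 - (sin πx/π) ∑_{j=-k}^{k-1} (-1)^j/(x - j)`.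

This is the key computational input of Zagier's Proposition 6 (`F(x, k) = F̂(x, k)` for `k ∈ ℕ`),
itself one of the three special-value propositions from which Theorem 1 of [Zagier2012] — the
evaluation of `ζ(2,…,2,3,2,…,2)`, i.e. Brown's [Brown2012, Thm 4.1], the hypothesis `hZ` of
`Brown2012.hoffmanSpan_eq_mzvSpace_of_uCoactionData` — is deduced.

We follow the printed proof ("the method of telescoping series") exactly:
* `Zagier2012.gbinom y n = C(y, n)` is the generalized binomial coefficient;
* Zagier's `a_{m,j} = C(x+m, m+j) C(m-x-1, m-j-1)` and
  `b_{m,j} = ½ (-1)^{m-j-1} (j/m + (2x+1)/(2m+1)) C(m+x, 2m) C(2m, m-j)` are encoded in the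
  natural-number coordinate `d = m - j` as `Zagier2012.A x m d`, `Zagier2012.B x m d`, both multiples
  of `Zagier2012.T x m d = (-1)^{d+1} C(x+m, 2m) C(2m, d)`
  (`a_{m,j} = (m-j)/(x-j) · T`, `b_{m,j} = ½ (j/m + (2x+1)/(2m+1)) · T`);
* `Zagier2012.A_succ_sub_A` is the identity `a_{m+1,j} - a_{m,j} = b_{m,j+1} - b_{m,j}`
  ("a direct computation");
* summing over the window `j ∈ [-k, k-1]` (`Zagier2012.S`) telescopes to
  `∑_{m=k}^{M-1} t_m = 1 - S_M` (`Zagier2012.sum_t_eq`; the base `S_k = 1` is the partial fraction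
  identity `Zagier2012.sum_neg_pow_choose_div`);
* `Zagier2012.A_window` is the closed form
  `a_{M,j} = (-1)^j/(x-j) · x ∏_{i<M} (1 - x²/i²) · (1 + x/M) · M!(M-1)!/((M+j)!(M-j-1)!)`, and Euler's
  product (`Complex.tendsto_euler_sin_prod`) gives the limit (`Zagier2012.tendsto_A_window`);
* `Zagier2012.zagier_lemma1` is Lemma 1, stated as the limit of the partial sums, in the coordinate
  `j = i - k` (`(-1)^j/(x-j) = (-1)^{i+k}/(x+k-i)`, `i < 2k`), for `x` off the poles `x = j`.

## References
* [Zagier2012] D. Zagier, Ann. of Math. 175 (2012), 977–1000, Lemma 1 and Proposition 6.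
* [Brown2012] F. Brown, Mixed Tate motives over ℤ, Ann. of Math. 175 (2012), Thm 4.1 / Lemma 4.2.
-/

noncomputable section

open Finset Filter Topology Real

namespace Literature.NumberTheory.Transcendental

namespace Zagier2012

/-- The generalized binomial coefficient `C(y, n) = y (y-1) ⋯ (y-n+1) / n!` for `y ∈ ℂ`. [folklore] -/
def gbinom (y : ℂ) (n : ℕ) : ℂ := (∏ i ∈ Finset.range n, (y - i)) / (n.factorial : ℂ)

/-- `C(y, 0) = 1`. [folklore] -/
@[simp] theorem gbinom_zero (y : ℂ) : gbinom y 0 = 1 := by simp [gbinom]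

/-- `C(y, n+1) = C(y, n) (y - n)/(n + 1)`. [folklore] -/
theorem gbinom_succ (y : ℂ) (n : ℕ) :
    gbinom y (n + 1) = gbinom y n * (y - n) / (n + 1) := by
  rw [gbinom, gbinom, Finset.prod_range_succ, Nat.factorial_succ]
  push_cast
  have : (n.factorial : ℂ) ≠ 0 := by exact_mod_cast n.factorial_ne_zero
  field_simp

/-- `C(y+1, n+2) = (y+1)(y-n) / ((n+1)(n+2)) · C(y, n)`. [folklore] -/
theorem gbinom_add_one_add_two (y : ℂ) (n : ℕ) :
    gbinom (y + 1) (n + 2) = gbinom y n * ((y + 1) * (y - n)) / ((n + 1) * (n + 2)) := by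
  have h : ∀ m : ℕ, gbinom (y + 1) (m + 1) = gbinom y m * (y + 1) / (m + 1) := by
    intro m
    induction m with
    | zero => simp [gbinom]
    | succ m ih =>
      rw [gbinom_succ, ih, gbinom_succ]
      have h1 : ((m : ℂ) + 1) ≠ 0 := by exact_mod_cast Nat.succ_ne_zero m
      have h2 : ((m : ℂ) + 1 + 1) ≠ 0 := by exact_mod_cast Nat.succ_ne_zero (m + 1)
      field_simp
      push_cast
      ring
  rw [h (n + 1), gbinom_succ]
  have h1 : ((n : ℂ) + 1) ≠ 0 := by exact_mod_cast Nat.succ_ne_zero n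
  have h2 : ((n : ℂ) + 2) ≠ 0 := by exact_mod_cast Nat.succ_ne_zero (n + 1)
  have h3 : ((2 : ℂ) + n) ≠ 0 := by rw [add_comm]; exact h2
  have h4 : ((n : ℂ) + 1 + 1) ≠ 0 := by rw [add_assoc]; norm_num; exact h2
  push_cast
  field_simp
  ring

/-- `C(N, n)` for a natural number `N` is the ordinary binomial coefficient. [folklore] -/
theorem gbinom_natCast (N n : ℕ) : gbinom (N : ℂ) n = (Nat.choose N n : ℂ) := by
  induction n with
  | zero => simp
  | succ n ih =>
    rw [gbinom_succ, ih]
    have h : ((n : ℂ) + 1) ≠ 0 := by exact_mod_cast Nat.succ_ne_zero n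
    rw [div_eq_iff h]
    have := Nat.choose_succ_right_eq N n
    -- choose N (n+1) * (n+1) = choose N n * (N - n)
    rcases le_or_gt n N with hle | hlt
    · have h2 : ((Nat.choose N (n + 1) : ℂ)) * (n + 1) = (Nat.choose N n : ℂ) * ((N : ℂ) - n) := by
        have := congrArg (fun t : ℕ => (t : ℂ)) this
        push_cast [Nat.cast_sub hle] at this
        exact this
      rw [h2]
    · rw [Nat.choose_eq_zero_of_lt hlt, Nat.choose_eq_zero_of_lt (by omega)]
      simp

variable (x : ℂ)

/-- `T_{m,d} = (-1)^{d+1} C(x+m, 2m) C(2m, d)` (`d = m - j`): the common factor of Zagier's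
`a_{m,j}` and `b_{m,j}`. [cite: Zagier2012, Lemma 1] -/
def T (m d : ℕ) : ℂ := (-1) ^ (d + 1) * gbinom (x + m) (2 * m) * (Nat.choose (2 * m) d : ℂ)

/-- Zagier's `a_{m,j} = C(x+m, m+j) C(m-x-1, m-j-1) = (m-j)/(x-j) · T_{m,m-j}` in the coordinate
`d = m - j`. [cite: Zagier2012, Lemma 1] -/
def A (m d : ℕ) : ℂ := (d : ℂ) / (x - m + d) * T x m d

/-- Zagier's `b_{m,j} = ½ (j/m + (2x+1)/(2m+1)) C(m+x,2m) C(2m,m-j) (-1)^{m-j-1}` in the coordinate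
`d = m - j`. [cite: Zagier2012, Lemma 1] -/
def B (m d : ℕ) : ℂ := (1 / 2) * (((m : ℂ) - d) / m + (2 * x + 1) / (2 * m + 1)) * T x m d

/-- `C(2m, d-1) (2m-d+1) = C(2m, d) d`. [folklore] -/
theorem choose_pred_mul {m d : ℕ} (hd : 1 ≤ d) :
    (Nat.choose (2 * m) (d - 1) : ℂ) * (2 * m - d + 1 : ℂ) = (Nat.choose (2 * m) d : ℂ) * d := by
  have h := Nat.choose_succ_right_eq (2 * m) (d - 1)
  rw [Nat.sub_add_cancel hd] at h
  -- h : choose (2m) d * d = choose (2m) (d-1) * (2m - (d-1))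
  rcases le_or_gt (d - 1) (2 * m) with hle | hlt
  · have := congrArg (fun t : ℕ => (t : ℂ)) h
    push_cast [Nat.cast_sub hle, Nat.cast_sub hd] at this
    linear_combination -this
  · rw [Nat.choose_eq_zero_of_lt hlt, Nat.choose_eq_zero_of_lt (by omega)]
    simp

/-- `C(2m+2, d+1) (d+1) (2m+1-d) = C(2m, d) (2m+2) (2m+1)` for `d ≤ 2m`. [folklore] -/
theorem choose_succ_succ_mul {m d : ℕ} (hd : d ≤ 2 * m) :
    (Nat.choose (2 * m + 2) (d + 1) : ℂ) * ((d : ℂ) + 1) * (2 * m + 1 - d : ℂ) =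
      (Nat.choose (2 * m) d : ℂ) * (2 * m + 2) * (2 * m + 1) := by
  have h1 := Nat.add_one_mul_choose_eq (2 * m + 1) d    -- (2m+2) * choose (2m+1) d = choose (2m+2) (d+1) * (d+1)
  have h2 := Nat.choose_mul_succ_eq (2 * m) d           -- choose (2m) d * (2m+1) = choose (2m+1) d * (2m+1-d)
  have e1 := congrArg (fun t : ℕ => (t : ℂ)) h1
  have e2 := congrArg (fun t : ℕ => (t : ℂ)) h2
  push_cast [Nat.cast_sub (show d ≤ 2 * m + 1 by omega)] at e1 e2
  rw [show 2 * m + 1 + 1 = 2 * m + 2 by ring] at e1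
  linear_combination (-(2 * m + 1 - d : ℂ)) * e1 - (2 * (m : ℂ) + 2) * e2

/-- `T_{m,d-1} (2m-d+1) = - T_{m,d} d`. [cite: Zagier2012, Lemma 1] -/
theorem T_pred_mul {m d : ℕ} (hd1 : 1 ≤ d) :
    T x m (d - 1) * (2 * m - d + 1 : ℂ) = -(T x m d * d) := by
  have := choose_pred_mul (m := m) hd1
  rw [T, T, show d - 1 + 1 = d by omega, pow_succ]
  linear_combination (-1) ^ d * gbinom (x + m) (2 * m) * this

/-- `T_{m+1,d+1} (d+1)(2m+1-d) = - T_{m,d} (x+m+1)(x-m)` for `d ≤ 2m`. [cite: Zagier2012, Lemma 1] -/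
theorem T_succ_succ_mul {m d : ℕ} (hd2 : d ≤ 2 * m) :
    T x (m + 1) (d + 1) * (((d : ℂ) + 1) * (2 * m + 1 - d : ℂ)) =
      -(T x m d * ((x + m + 1) * (x - m))) := by
  have h2m1 : (2 * (m : ℂ) + 1) ≠ 0 := by exact_mod_cast (show 2 * m + 1 ≠ 0 by omega)
  have h2m2 : (2 * (m : ℂ) + 2) ≠ 0 := by exact_mod_cast (show 2 * m + 2 ≠ 0 by omega)
  have hc := choose_succ_succ_mul (m := m) hd2
  have hg := gbinom_add_one_add_two (x + m) (2 * m)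
  have hg' : gbinom (x + m + 1) (2 * m + 2) * ((2 * m + 1) * (2 * m + 2)) =
      gbinom (x + m) (2 * m) * ((x + m + 1) * (x + m - 2 * m)) := by
    rw [hg]
    push_cast
    rw [div_mul_cancel₀ _ (mul_ne_zero h2m1 h2m2)]
  have key : T x (m + 1) (d + 1) * (((d : ℂ) + 1) * (2 * m + 1 - d : ℂ)) * ((2 * m + 1) * (2 * m + 2)) =
      -(T x m d * ((x + m + 1) * (x - m))) * ((2 * m + 1) * (2 * m + 2)) := by
    rw [T, T, show 2 * (m + 1) = 2 * m + 2 by ring, show x + ((m + 1 : ℕ) : ℂ) = x + m + 1 by push_cast; ring,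
      pow_succ ((-1 : ℂ)) (d + 1)]
    linear_combination ((-1 : ℂ) ^ (d + 1) * (-1) * ((d : ℂ) + 1) * (2 * m + 1 - d : ℂ) *
        (Nat.choose (2 * m + 2) (d + 1) : ℂ)) * hg' +
      ((-1 : ℂ) ^ (d + 1) * (-1) * gbinom (x + m) (2 * m) * (x + m + 1) * (x + m - 2 * m)) * hc
  exact mul_right_cancel₀ (mul_ne_zero h2m1 h2m2) key

/-- The rational-function identity behind `a_{m+1,j} - a_{m,j} = b_{m,j+1} - b_{m,j}` (per unit
`T_{m,d}`). [folklore] -/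
theorem key_identity (x M D : ℂ) (h1 : x - M + D ≠ 0) (h2 : M ≠ 0) (h3 : 2 * M + 1 ≠ 0)
    (h4 : D + 1 ≠ 0) (h5 : 2 * M + 1 - D ≠ 0) :
    (D + 1) / (x - M + D) * (-((x + M + 1) * (x - M)) / ((D + 1) * (2 * M + 1 - D))) -
        D / (x - M + D) =
      1 / 2 * ((M - (D - 1)) / M + (2 * x + 1) / (2 * M + 1)) * (-D / (2 * M - D + 1)) -
        1 / 2 * ((M - D) / M + (2 * x + 1) / (2 * M + 1)) := by
  have e6 : 2 * M - D + 1 = 2 * M + 1 - D := by ring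
  rw [e6]
  set u := 2 * M + 1 - D with hu
  set v := 2 * M + 1 with hv
  set w := x - M + D with hw
  have hu0 : u ≠ 0 := h5
  have hv0 : v ≠ 0 := h3
  have hw0 : w ≠ 0 := h1
  field_simp
  rw [hu, hv, hw]
  ring

/-- **Zagier's telescoping identity** `a_{m+1,j} - a_{m,j} = b_{m,j+1} - b_{m,j}` (proof of Lemma 1),
in the coordinate `d = m - j`, for `1 ≤ d ≤ 2m` and away from the pole `x = j`. [cite: Zagier2012, Lemma 1] -/
theorem A_succ_sub_A {m d : ℕ} (hd1 : 1 ≤ d) (hd2 : d ≤ 2 * m) (hx : x - m + d ≠ 0) :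
    A x (m + 1) (d + 1) - A x m d = B x m (d - 1) - B x m d := by
  have hm : (m : ℂ) ≠ 0 := by exact_mod_cast (show m ≠ 0 by omega)
  have h2m1 : (2 * (m : ℂ) + 1) ≠ 0 := by exact_mod_cast (show 2 * m + 1 ≠ 0 by omega)
  have hdd : ((d : ℂ) + 1) ≠ 0 := by exact_mod_cast Nat.succ_ne_zero d
  have hcd : (2 * m + 1 - d : ℂ) ≠ 0 := by
    have : (2 * m + 1 - d : ℂ) = ((2 * m + 1 - d : ℕ) : ℂ) := by
      push_cast [Nat.cast_sub (show d ≤ 2 * m + 1 by omega)]; ring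
    rw [this]; exact_mod_cast (show 2 * m + 1 - d ≠ 0 by omega)
  have hcd' : (2 * m - d + 1 : ℂ) ≠ 0 := by
    intro h; apply hcd; linear_combination h
  have e1 : T x (m + 1) (d + 1) =
      T x m d * (-((x + m + 1) * (x - m)) / (((d : ℂ) + 1) * (2 * m + 1 - d))) := by
    rw [mul_div_assoc', eq_div_iff (mul_ne_zero hdd hcd)]
    have := T_succ_succ_mul x hd2 (m := m)
    linear_combination this
  have e2 : T x m (d - 1) = T x m d * (-(d : ℂ) / (2 * m - d + 1)) := by
    rw [mul_div_assoc', eq_div_iff hcd']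
    have := T_pred_mul x hd1 (m := m)
    linear_combination this
  have key := key_identity x m d hx hm h2m1 hdd hcd
  calc A x (m + 1) (d + 1) - A x m d
      = (((d : ℂ) + 1) / (x - m + d) * (-((x + m + 1) * (x - m)) / (((d : ℂ) + 1) * (2 * m + 1 - d))) -
          d / (x - m + d)) * T x m d := by
        rw [A, A, e1]
        push_cast
        ring
    _ = (1 / 2 * (((m : ℂ) - (d - 1)) / m + (2 * x + 1) / (2 * m + 1)) * (-(d : ℂ) / (2 * m - d + 1)) -
          1 / 2 * (((m : ℂ) - d) / m + (2 * x + 1) / (2 * m + 1))) * T x m d := by rw [key]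
    _ = B x m (d - 1) - B x m d := by
        rw [B, B, e2]
        push_cast [Nat.cast_sub hd1]
        ring

/-! ### The telescoping sum -/

/-- The window sum `S_m = ∑_{j=-k}^{k-1} a_{m,j} = ∑_{i<2k} A_{m, m+k-i}` (`j = i - k`, `d = m - j`). [cite: Zagier2012, Lemma 1] -/
def S (k m : ℕ) : ℂ := ∑ i ∈ Finset.range (2 * k), A x m (m + k - i)

/-- The summand of `f_k(x)`: `t_m = (-1)^{m-k} (k/m) C(x+m, 2m) C(2m, m-k)`. [cite: Zagier2012, Lemma 1] -/
def t (k m : ℕ) : ℂ :=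
  (-1) ^ (m - k) * ((k : ℂ) / m) * gbinom (x + m) (2 * m) * (Nat.choose (2 * m) (m - k) : ℂ)

/-- `b_{m,k} - b_{m,-k} = -t_m`: `B_{m,m-k} - B_{m,m+k} = -t_m` for `k ≤ m`. [cite: Zagier2012, Lemma 1] -/
theorem B_sub_B_eq {k m : ℕ} (hk : 1 ≤ k) (hkm : k ≤ m) : B x m (m - k) - B x m (m + k) = -t x k m := by
  have hm : (m : ℂ) ≠ 0 := by exact_mod_cast (show m ≠ 0 by omega)
  have h2m1 : (2 * (m : ℂ) + 1) ≠ 0 := by exact_mod_cast (show 2 * m + 1 ≠ 0 by omega)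
  have hT : T x m (m + k) = T x m (m - k) := by
    rw [T, T, Nat.choose_symm_of_eq_add (by omega : 2 * m = (m - k) + (m + k)),
      show m + k + 1 = (m - k + 1) + 2 * k by omega, pow_add, pow_mul, neg_one_sq, one_pow, mul_one]
  rw [B, B, hT, t, T]
  push_cast [Nat.cast_sub hkm]
  field_simp
  ring

/-- The telescoping step `S_{m+1} = S_m - t_m` for `m ≥ k` (away from the poles `x = j`). [cite: Zagier2012, Lemma 1] -/
theorem S_succ {k m : ℕ} (hk : 1 ≤ k) (hkm : k ≤ m) (hx : ∀ i : ℕ, i < 2 * k → x + k - i ≠ 0) :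
    S x k (m + 1) = S x k m - t x k m := by
  have hstep : ∀ i ∈ Finset.range (2 * k),
      A x (m + 1) (m + 1 + k - i) - A x m (m + k - i) = B x m (m + k - (i + 1)) - B x m (m + k - i) := by
    intro i hi
    have hi' := Finset.mem_range.1 hi
    have h := A_succ_sub_A x (m := m) (d := m + k - i) (by omega) (by omega) (by
      have := hx i hi'
      intro h0; apply this
      have : ((m + k - i : ℕ) : ℂ) = m + k - i := by push_cast [Nat.cast_sub (show i ≤ m + k by omega)]; ring
      rw [this] at h0
      linear_combination h0)
    rw [show m + 1 + k - i = m + k - i + 1 by omega, show m + k - (i + 1) = m + k - i - 1 by omega]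
    exact h
  have hsum : S x k (m + 1) - S x k m = B x m (m - k) - B x m (m + k) := by
    rw [S, S, ← Finset.sum_sub_distrib, Finset.sum_congr rfl hstep,
      Finset.sum_range_sub (fun i => B x m (m + k - i)), show m + k - 2 * k = m - k by omega, Nat.sub_zero]
  rw [B_sub_B_eq x hk hkm] at hsum
  linear_combination hsum

/-- `S_M = S_k - ∑_{m=k}^{M-1} t_m` for `M ≥ k`. [cite: Zagier2012, Lemma 1] -/
theorem S_eq {k : ℕ} (hk : 1 ≤ k) (hx : ∀ i : ℕ, i < 2 * k → x + k - i ≠ 0) {M : ℕ} (hM : k ≤ M) :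
    S x k M = S x k k - ∑ m ∈ Finset.Ico k M, t x k m := by
  induction M, hM using Nat.le_induction with
  | base => simp
  | succ M hM ih =>
    rw [S_succ x hk hM hx, ih, Finset.sum_Ico_succ_top hM]
    ring

/-! ### The base `S_k = 1`: a partial fraction identity -/

/-- **Partial fractions**: `∑_{e=0}^{n} (-1)^e C(n,e)/(z+e) = n!/(z(z+1)⋯(z+n))`. [folklore] -/
theorem sum_neg_pow_choose_div (n : ℕ) (z : ℂ) (hz : ∀ e : ℕ, e ≤ n → z + e ≠ 0) :
    ∑ e ∈ Finset.range (n + 1), (-1 : ℂ) ^ e * (Nat.choose n e : ℂ) / (z + e) =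
      (n.factorial : ℂ) / ∏ e ∈ Finset.range (n + 1), (z + e) := by
  induction n generalizing z with
  | zero => simp
  | succ n ih =>
    have hz0 : z ≠ 0 := by simpa using hz 0 (Nat.zero_le _)
    have hz1 : ∀ e : ℕ, e ≤ n → z + 1 + e ≠ 0 := fun e he => by
      have := hz (e + 1) (by omega); push_cast at this; intro h; apply this; linear_combination h
    have hzn : ∀ e : ℕ, e ≤ n → z + e ≠ 0 := fun e he => hz e (by omega)
    -- Pascal: L(n+1, z) = L(n, z) - L(n, z+1)
    have h1 : ∑ e ∈ Finset.range (n + 1 + 1), (-1 : ℂ) ^ e * (Nat.choose (n + 1) e : ℂ) / (z + e) =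
        (∑ e ∈ Finset.range (n + 1), (-1 : ℂ) ^ (e + 1) * (Nat.choose (n + 1) (e + 1) : ℂ) / (z + ((e + 1 : ℕ) : ℂ))) +
          1 / z := by
      rw [Finset.sum_range_succ']
      simp
    have h2 : ∑ e ∈ Finset.range (n + 1), (-1 : ℂ) ^ (e + 1) * (Nat.choose (n + 1) (e + 1) : ℂ) / (z + ((e + 1 : ℕ) : ℂ)) =
        -(∑ e ∈ Finset.range (n + 1), (-1 : ℂ) ^ e * (Nat.choose n e : ℂ) / (z + 1 + e)) +
          ∑ e ∈ Finset.range (n + 1), (-1 : ℂ) ^ (e + 1) * (Nat.choose n (e + 1) : ℂ) / (z + ((e + 1 : ℕ) : ℂ)) := by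
      rw [← Finset.sum_neg_distrib, ← Finset.sum_add_distrib]
      refine Finset.sum_congr rfl fun e _ => ?_
      rw [Nat.choose_succ_succ']
      push_cast
      ring
    have h3 : (∑ e ∈ Finset.range (n + 1), (-1 : ℂ) ^ (e + 1) * (Nat.choose n (e + 1) : ℂ) / (z + ((e + 1 : ℕ) : ℂ))) +
        1 / z = ∑ e ∈ Finset.range (n + 1), (-1 : ℂ) ^ e * (Nat.choose n e : ℂ) / (z + e) := by
      have : ∑ e ∈ Finset.range (n + 1), (-1 : ℂ) ^ e * (Nat.choose n e : ℂ) / (z + e) =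
          ∑ e ∈ Finset.range (n + 1 + 1), (-1 : ℂ) ^ e * (Nat.choose n e : ℂ) / (z + e) := by
        symm
        rw [Finset.sum_range_succ, Nat.choose_succ_self]
        simp
      rw [this, Finset.sum_range_succ' (fun e => (-1 : ℂ) ^ e * (Nat.choose n e : ℂ) / (z + e))]
      simp
    rw [h1, h2, add_assoc, h3, ih z hzn, ih (z + 1) hz1]
    -- the products
    set Q := ∏ e ∈ Finset.range n, (z + 1 + (e : ℂ)) with hQ
    have hQ0 : Q ≠ 0 := Finset.prod_ne_zero_iff.2 fun e he => hz1 e (by have := Finset.mem_range.1 he; omega)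
    have hzn1 : z + 1 + (n : ℂ) ≠ 0 := hz1 n le_rfl
    have hA : ∏ e ∈ Finset.range (n + 1), (z + (e : ℂ)) = z * Q := by
      rw [Finset.prod_range_succ', Nat.cast_zero, add_zero, mul_comm]
      congr 1
      exact Finset.prod_congr rfl fun e _ => by push_cast; ring
    have hB : ∏ e ∈ Finset.range (n + 1), (z + 1 + (e : ℂ)) = Q * (z + 1 + n) := Finset.prod_range_succ _ _
    have hC : ∏ e ∈ Finset.range (n + 1 + 1), (z + (e : ℂ)) = z * (Q * (z + 1 + n)) := by
      rw [Finset.prod_range_succ', Nat.cast_zero, add_zero, mul_comm, ← hB]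
      congr 1
      exact Finset.prod_congr rfl fun e _ => by push_cast; ring
    rw [hA, hB, hC, Nat.factorial_succ]
    push_cast
    field_simp
    ring

/-- **The base of the telescope: `S_k = 1`**, i.e. `∑_{j=-k}^{k-1} a_{k,j} = 1`, by the partial
fraction identity. [cite: Zagier2012, Lemma 1] -/
theorem S_self {k : ℕ} (hk : 1 ≤ k) (hx : ∀ i : ℕ, i < 2 * k → x + k - i ≠ 0) : S x k k = 1 := by
  -- reflect the window: `S_k = ∑_{e<2k} A_{k,e+1}`
  have hS : S x k k = ∑ e ∈ Finset.range (2 * k), A x k (e + 1) := by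
    rw [S, ← Finset.sum_range_reflect (fun e => A x k (e + 1)) (2 * k)]
    refine Finset.sum_congr rfl fun i hi => ?_
    have := Finset.mem_range.1 hi
    congr 1
    omega
  set z : ℂ := x - k + 1 with hz
  have hz' : ∀ e : ℕ, e ≤ 2 * k - 1 → z + e ≠ 0 := by
    intro e he h0
    apply hx (2 * k - 1 - e) (by omega)
    have : ((2 * k - 1 - e : ℕ) : ℂ) = 2 * k - 1 - e := by
      push_cast [Nat.cast_sub (show e ≤ 2 * k - 1 by omega), Nat.cast_sub (show 1 ≤ 2 * k by omega)]
      ring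
    rw [this]
    linear_combination h0
  -- each term
  have hterm : ∀ e ∈ Finset.range (2 * k), A x k (e + 1) =
      gbinom (x + k) (2 * k) * (2 * k) * ((-1 : ℂ) ^ e * (Nat.choose (2 * k - 1) e : ℂ) / (z + e)) := by
    intro e he
    have hc := Nat.add_one_mul_choose_eq (2 * k - 1) e
    rw [show 2 * k - 1 + 1 = 2 * k by omega] at hc
    have hc' : ((Nat.choose (2 * k) (e + 1) : ℂ)) * ((e : ℂ) + 1) = 2 * k * (Nat.choose (2 * k - 1) e : ℂ) := by
      exact_mod_cast hc.symm
    rw [A, T, show x - (k : ℂ) + ((e + 1 : ℕ) : ℂ) = z + e by push_cast; rw [hz]; ring, pow_succ, pow_succ,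
      ← mul_div_assoc (gbinom (x + ↑k) (2 * k) * (2 * ↑k)), div_mul_eq_mul_div,
      div_left_inj' (hz' e (by have := Finset.mem_range.1 he; omega))]
    push_cast
    linear_combination (-1) ^ e * gbinom (x + ↑k) (2 * k) * hc'
  have hpf := sum_neg_pow_choose_div (2 * k - 1) z hz'
  rw [show 2 * k - 1 + 1 = 2 * k by omega] at hpf
  rw [hS, Finset.sum_congr rfl hterm, ← Finset.mul_sum, hpf]
  -- `gbinom (x+k) (2k) = ∏_{e<2k} (z + e) / (2k)!`
  have hprod : ∏ e ∈ Finset.range (2 * k), (z + (e : ℂ)) = ∏ i ∈ Finset.range (2 * k), (x + k - (i : ℂ)) := by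
    rw [← Finset.prod_range_reflect (fun i : ℕ => x + k - (i : ℂ)) (2 * k)]
    refine Finset.prod_congr rfl fun e he => ?_
    have := Finset.mem_range.1 he
    rw [hz]
    push_cast [Nat.cast_sub (show e ≤ 2 * k - 1 by omega), Nat.cast_sub (show 1 ≤ 2 * k by omega)]
    ring
  have hP : ∏ i ∈ Finset.range (2 * k), (x + k - (i : ℂ)) ≠ 0 :=
    Finset.prod_ne_zero_iff.2 fun i hi => hx i (Finset.mem_range.1 hi)
  have hfac : ((2 * k).factorial : ℂ) = 2 * k * ((2 * k - 1).factorial : ℂ) := by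
    rw [show 2 * k = (2 * k - 1) + 1 by omega, Nat.factorial_succ, show 2 * k - 1 + 1 = 2 * k by omega]
    push_cast
    ring
  rw [hprod, gbinom, hfac]
  have h2k : (2 * (k : ℂ)) ≠ 0 := by exact_mod_cast (show 2 * k ≠ 0 by omega)
  have hk0 : (k : ℂ) ≠ 0 := by exact_mod_cast (show k ≠ 0 by omega)
  have hf : ((2 * k - 1).factorial : ℂ) ≠ 0 := by exact_mod_cast Nat.factorial_ne_zero _
  field_simp

/-- **The partial sums of `f_k`**: `∑_{m=k}^{M-1} t_m = 1 - S_M` (`M ≥ k`). [cite: Zagier2012, Lemma 1] -/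
theorem sum_t_eq {k : ℕ} (hk : 1 ≤ k) (hx : ∀ i : ℕ, i < 2 * k → x + k - i ≠ 0) {M : ℕ} (hM : k ≤ M) :
    ∑ m ∈ Finset.Ico k M, t x k m = 1 - S x k M := by
  rw [S_eq x hk hx hM, S_self x hk hx]
  ring

/-! ### The closed form of `a_{M,j}` and its limit -/

/-- `(2M)! C(x+M, 2M) = (x+M) · x (-1)^{M-1} ((M-1)!)² ∏_{l<M-1} (1 - x²/(l+1)²)` (`M ≥ 1`). [folklore] -/
theorem gbinom_closed {M : ℕ} (hM : 1 ≤ M) :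
    ((2 * M).factorial : ℂ) * gbinom (x + M) (2 * M) =
      (x + M) * (x * (-1) ^ (M - 1) * (((M - 1).factorial : ℂ)) ^ 2 *
        ∏ l ∈ Finset.range (M - 1), (1 - x ^ 2 / ((l : ℂ) + 1) ^ 2)) := by
  induction M, hM using Nat.le_induction with
  | base =>
    simp [gbinom, Finset.prod_range_succ]
    ring
  | succ M hM ih =>
    have h2m1 : (2 * (M : ℂ) + 1) ≠ 0 := by exact_mod_cast (show 2 * M + 1 ≠ 0 by omega)
    have h2m2 : (2 * (M : ℂ) + 2) ≠ 0 := by exact_mod_cast (show 2 * M + 2 ≠ 0 by omega)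
    have hM0 : (M : ℂ) ≠ 0 := by exact_mod_cast (show M ≠ 0 by omega)
    have e1 : ((2 * (M + 1)).factorial : ℂ) * gbinom (x + ((M + 1 : ℕ) : ℂ)) (2 * (M + 1)) =
        (((2 * M).factorial : ℂ) * gbinom (x + M) (2 * M)) * ((x + M + 1) * (x - M)) := by
      rw [show 2 * (M + 1) = 2 * M + 1 + 1 by ring, show (x + ((M + 1 : ℕ) : ℂ)) = (x + M) + 1 by push_cast; ring,
        gbinom_add_one_add_two, Nat.factorial_succ, Nat.factorial_succ]
      push_cast
      field_simp
      ring
    rw [e1, ih, show M + 1 - 1 = (M - 1) + 1 by omega, Finset.prod_range_succ, Nat.factorial_succ]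
    push_cast [Nat.cast_sub hM]
    have hM1 : (M : ℂ) - 1 + 1 ≠ 0 := by rw [sub_add_cancel]; exact hM0
    field_simp
    ring

/-- **The closed form of `a_{M,j}`** (Zagier: "`a_{M,j} = (-1)^j/(x-j) · x(1 - x²/1²)⋯(1 - x²/(M-1)²)
· (1 + x/M) · M!(M-1)!/((M+j)!(M-j-1)!)`"), in the coordinates `j = i - k`, `d = M + k - i`. [cite: Zagier2012, Lemma 1] -/
theorem A_window {k i M : ℕ} (hk : 1 ≤ k) (hi : i < 2 * k) (hM : 2 * k ≤ M) (hx : x + k - i ≠ 0) :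
    A x M (M + k - i) = (-1) ^ (i + k) / (x + k - i) *
      (x * ∏ l ∈ Finset.range (M - 1), (1 - x ^ 2 / ((l : ℂ) + 1) ^ 2)) * ((x + M) / M) *
      (((M.factorial * (M - 1).factorial : ℕ) : ℂ) /
        (((M + k - i - 1).factorial * (M - k + i).factorial : ℕ) : ℂ)) := by
  set d := M + k - i with hd
  have hd1 : 1 ≤ d := by omega
  have hd2 : d ≤ 2 * M := by omega
  have hM1 : 1 ≤ M := by omega
  -- the atoms
  set F2 : ℂ := ((2 * M).factorial : ℂ) with hF2
  set Fm1 : ℂ := ((M - 1).factorial : ℂ) with hFm1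
  set Fd1 : ℂ := ((d - 1).factorial : ℂ) with hFd1
  set F2d : ℂ := ((2 * M - d).factorial : ℂ) with hF2d
  set P : ℂ := ∏ l ∈ Finset.range (M - 1), (1 - x ^ 2 / ((l : ℂ) + 1) ^ 2) with hP
  have hF2ne : F2 ≠ 0 := by rw [hF2]; exact_mod_cast Nat.factorial_ne_zero _
  have hFd1ne : Fd1 ≠ 0 := by rw [hFd1]; exact_mod_cast Nat.factorial_ne_zero _
  have hF2dne : F2d ≠ 0 := by rw [hF2d]; exact_mod_cast Nat.factorial_ne_zero _
  have hFm1ne : Fm1 ≠ 0 := by rw [hFm1]; exact_mod_cast Nat.factorial_ne_zero _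
  have hMne : (M : ℂ) ≠ 0 := by exact_mod_cast (show M ≠ 0 by omega)
  have hdne : (d : ℂ) ≠ 0 := by exact_mod_cast (show d ≠ 0 by omega)
  -- factorial relations
  have hMfac : ((M.factorial : ℕ) : ℂ) = M * Fm1 := by
    rw [hFm1, ← Nat.mul_factorial_pred (show M ≠ 0 by omega)]; push_cast; ring
  have hdfac : ((d.factorial : ℕ) : ℂ) = d * Fd1 := by
    rw [hFd1, ← Nat.mul_factorial_pred (show d ≠ 0 by omega)]; push_cast; ring
  have hC : (Nat.choose (2 * M) d : ℂ) * (d * Fd1) * F2d = F2 := by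
    rw [← hdfac, hF2d, hF2]
    exact_mod_cast Nat.choose_mul_factorial_mul_factorial hd2
  have hG : F2 * gbinom (x + M) (2 * M) = (x + M) * (x * (-1) ^ (M - 1) * Fm1 ^ 2 * P) := gbinom_closed x hM1
  -- the sign
  have hsign : (-1 : ℂ) ^ (d + 1) * (-1) ^ (M - 1) = (-1) ^ (i + k) := by
    rw [← pow_add, show d + 1 + (M - 1) = (i + k) + 2 * (M - i) by omega, pow_add, pow_mul, neg_one_sq, one_pow,
      mul_one]
  -- the denominators of `A`
  have hden : x - (M : ℂ) + ((d : ℕ) : ℂ) = x + k - i := by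
    rw [hd]; push_cast [Nat.cast_sub (show i ≤ M + k by omega)]; ring
  have hidx1 : M + k - i - 1 = d - 1 := by omega
  have hidx2 : M - k + i = 2 * M - d := by omega
  rw [A, T, hden, hidx1, hidx2]
  push_cast
  rw [← hFd1, ← hF2d, hMfac, ← hFm1]
  -- substitute `gbinom` and `choose`
  have hGe : gbinom (x + M) (2 * M) = (x + M) * (x * (-1) ^ (M - 1) * Fm1 ^ 2 * P) / F2 := by
    rw [eq_div_iff hF2ne, mul_comm, hG]
  have hCe : (Nat.choose (2 * M) d : ℂ) = F2 / ((d * Fd1) * F2d) := by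
    rw [eq_div_iff (mul_ne_zero (mul_ne_zero hdne hFd1ne) hF2dne), ← hC]; ring
  rw [hGe, hCe]
  rw [show (-1 : ℂ) ^ (i + k) = (-1) ^ (d + 1) * (-1) ^ (M - 1) from hsign.symm]
  field_simp

/-! ### Limits -/

/-- `x ∏_{l<M-1} (1 - x²/(l+1)²) → sin(πx)/π` (Euler). [folklore] -/
theorem tendsto_x_mul_prod :
    Tendsto (fun M : ℕ => x * ∏ l ∈ Finset.range (M - 1), (1 - x ^ 2 / ((l : ℂ) + 1) ^ 2)) atTop
      (𝓝 (Complex.sin (π * x) / π)) := by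
  have hπ : (π : ℂ) ≠ 0 := by exact_mod_cast Real.pi_ne_zero
  have h := (Complex.tendsto_euler_sin_prod x).comp (tendsto_sub_atTop_nat 1)
  have h2 := h.const_mul ((π : ℂ)⁻¹)
  rw [show (π : ℂ)⁻¹ * Complex.sin (π * x) = Complex.sin (π * x) / π by field_simp] at h2
  refine h2.congr fun M => ?_
  simp only [Function.comp_apply]
  field_simp

/-- `((M - a) : ℕ) / ((M + b) : ℕ) → 1`. [folklore] -/
theorem tendsto_natCast_sub_div_add (a b : ℕ) :
    Tendsto (fun M : ℕ => (((M - a : ℕ) : ℂ)) / ((M + b : ℕ) : ℂ)) atTop (𝓝 1) := by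
  -- the real sequence
  have hr : Tendsto (fun M : ℕ => (((M - a : ℕ) : ℝ)) / ((M + b : ℕ) : ℝ)) atTop (𝓝 1) := by
    have h1 : Tendsto (fun M : ℕ => ((M : ℝ)) / ((M : ℝ) + b)) atTop (𝓝 1) := tendsto_natCast_div_add_atTop (b : ℝ)
    have h2 : Tendsto (fun M : ℕ => (a : ℝ) / ((M + b : ℕ) : ℝ)) atTop (𝓝 0) :=
      (tendsto_const_div_atTop_nhds_zero_nat (a : ℝ)).comp (tendsto_add_atTop_nat b)
    have h3 := h1.sub h2
    rw [sub_zero] at h3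
    refine h3.congr' ?_
    filter_upwards [Filter.eventually_ge_atTop (a + 1)] with M hM
    push_cast [Nat.cast_sub (show a ≤ M by omega)]
    have h1 : (1 : ℝ) ≤ M := by exact_mod_cast (show 1 ≤ M by omega)
    have hb : (0 : ℝ) ≤ b := Nat.cast_nonneg b
    have : ((M : ℝ) + b) ≠ 0 := ne_of_gt (by linarith)
    field_simp
  have hc := (Complex.continuous_ofReal.tendsto 1).comp hr
  simp only [Function.comp_def, Complex.ofReal_one] at hc
  refine hc.congr fun M => ?_
  push_cast
  rfl

/-- The factorial ratio `M!(M-1)!/((M+j)!(M-j-1)!) → 1` (here `j = i - k`, in the coordinates of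
`A_window`). [cite: Zagier2012, Lemma 1] -/
theorem tendsto_factorial_ratio {k i : ℕ} (hi : i < 2 * k) :
    Tendsto (fun M : ℕ => ((M.factorial * (M - 1).factorial : ℕ) : ℂ) /
      (((M + k - i - 1).factorial * (M - k + i).factorial : ℕ) : ℂ)) atTop (𝓝 1) := by
  rcases le_or_gt k i with hki | hik
  · -- `j = i - k ≥ 0`: the ratio is `∏_{l<j} (M-1-l)/(M+1+l)`
    set j := i - k with hj
    have hlim : Tendsto (fun M : ℕ => ∏ l ∈ Finset.range j, (((M - (l + 1) : ℕ) : ℂ) / ((M + (l + 1) : ℕ) : ℂ)))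
        atTop (𝓝 1) := by
      rw [show (1 : ℂ) = ∏ l ∈ Finset.range j, 1 by simp]
      exact tendsto_finsetProd _ fun l _ => tendsto_natCast_sub_div_add (l + 1) (l + 1)
    refine hlim.congr' ?_
    filter_upwards [Filter.eventually_ge_atTop (2 * k + 1)] with M hM
    have hd : (M - 1).descFactorial j * (M + k - i - 1).factorial = (M - 1).factorial := by
      rw [show M + k - i - 1 = (M - 1) - j by omega, mul_comm]
      exact Nat.factorial_mul_descFactorial (by omega)
    have ha : M.factorial * (M + 1).ascFactorial j = (M - k + i).factorial := by
      rw [show M - k + i = M + j by omega]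
      exact Nat.factorial_mul_ascFactorial M j
    have hne : ((((M + k - i - 1).factorial * (M - k + i).factorial : ℕ)) : ℂ) ≠ 0 := by
      exact_mod_cast (mul_ne_zero (Nat.factorial_ne_zero _) (Nat.factorial_ne_zero _))
    rw [eq_div_iff hne, Nat.descFactorial_eq_prod_range] at *
    rw [Finset.prod_div_distrib]
    have hasc : (M + 1).ascFactorial j = ∏ l ∈ Finset.range j, (M + (l + 1)) := by
      rw [Nat.ascFactorial_eq_prod_range]; exact Finset.prod_congr rfl fun l _ => by ring
    have hden : ∏ l ∈ Finset.range j, (((M + (l + 1) : ℕ)) : ℂ) ≠ 0 :=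
      Finset.prod_ne_zero_iff.2 fun l _ => by exact_mod_cast (show M + (l + 1) ≠ 0 by omega)
    rw [div_mul_eq_mul_div, div_eq_iff hden]
    have key : M.factorial * (M - 1).factorial * (∏ l ∈ Finset.range j, (M + (l + 1))) =
        (∏ l ∈ Finset.range j, (M - 1 - l)) * ((M + k - i - 1).factorial * (M - k + i).factorial) := by
      rw [← hasc]
      calc M.factorial * (M - 1).factorial * (M + 1).ascFactorial j
          = (M - 1).factorial * (M.factorial * (M + 1).ascFactorial j) := by ring
        _ = (M - 1).factorial * (M - k + i).factorial := by rw [ha]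
        _ = (∏ l ∈ Finset.range j, (M - 1 - l)) * (M + k - i - 1).factorial * (M - k + i).factorial := by rw [hd]
        _ = _ := by ring
    have key' := congrArg (fun t : ℕ => (t : ℂ)) key
    push_cast at key' ⊢
    have hprod : ∏ l ∈ Finset.range j, (((M - (l + 1) : ℕ)) : ℂ) = ∏ l ∈ Finset.range j, (((M - 1 - l : ℕ)) : ℂ) :=
      Finset.prod_congr rfl fun l _ => by congr 1; omega
    rw [hprod]
    linear_combination key'.symm
  · -- `j' = k - i ≥ 1`: the ratio is `∏_{l<j'} (M-l)/(M+l)`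
    set j := k - i with hj
    have hlim : Tendsto (fun M : ℕ => ∏ l ∈ Finset.range j, (((M - l : ℕ) : ℂ) / ((M + l : ℕ) : ℂ)))
        atTop (𝓝 1) := by
      rw [show (1 : ℂ) = ∏ l ∈ Finset.range j, 1 by simp]
      exact tendsto_finsetProd _ fun l _ => tendsto_natCast_sub_div_add l l
    refine hlim.congr' ?_
    filter_upwards [Filter.eventually_ge_atTop (2 * k + 1)] with M hM
    have hd : (M - k + i).factorial * M.descFactorial j = M.factorial := by
      rw [show M - k + i = M - j by omega]
      exact Nat.factorial_mul_descFactorial (by omega)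
    have ha : (M - 1).factorial * M.ascFactorial j = (M + k - i - 1).factorial := by
      have := Nat.factorial_mul_ascFactorial (M - 1) j
      rw [show M - 1 + 1 = M by omega, show M - 1 + j = M + k - i - 1 by omega] at this
      exact this
    have hne : ((((M + k - i - 1).factorial * (M - k + i).factorial : ℕ)) : ℂ) ≠ 0 := by
      exact_mod_cast (mul_ne_zero (Nat.factorial_ne_zero _) (Nat.factorial_ne_zero _))
    rw [eq_div_iff hne, Finset.prod_div_distrib]
    have hden : ∏ l ∈ Finset.range j, (((M + l : ℕ)) : ℂ) ≠ 0 :=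
      Finset.prod_ne_zero_iff.2 fun l _ => by exact_mod_cast (show M + l ≠ 0 by omega)
    rw [div_mul_eq_mul_div, div_eq_iff hden]
    have key : (M.descFactorial j) * ((M + k - i - 1).factorial * (M - k + i).factorial) =
        (M.factorial * (M - 1).factorial) * M.ascFactorial j := by
      rw [← hd, ← ha]; ring
    rw [Nat.descFactorial_eq_prod_range, Nat.ascFactorial_eq_prod_range] at key
    have key' := congrArg (fun t : ℕ => (t : ℂ)) key
    push_cast at key' ⊢
    linear_combination key'

/-- **The limit of the window terms**: `a_{M,j} → (-1)^j sin(πx)/(π(x-j))` (`j = i - k`). [cite: Zagier2012, Lemma 1] -/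
theorem tendsto_A_window {k i : ℕ} (hk : 1 ≤ k) (hi : i < 2 * k) (hx : x + k - i ≠ 0) :
    Tendsto (fun M : ℕ => A x M (M + k - i)) atTop
      (𝓝 ((-1) ^ (i + k) / (x + k - i) * (Complex.sin (π * x) / π))) := by
  have hM : Tendsto (fun M : ℕ => (x + (M : ℂ)) / M) atTop (𝓝 1) := by
    have h0 : Tendsto (fun M : ℕ => x / (M : ℂ)) atTop (𝓝 0) := by
      rw [tendsto_zero_iff_norm_tendsto_zero]
      have := tendsto_const_div_atTop_nhds_zero_nat ‖x‖
      refine this.congr fun M => ?_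
      simp
    have h1 := h0.add_const 1
    rw [zero_add] at h1
    refine h1.congr' ?_
    filter_upwards [Filter.eventually_ge_atTop 1] with M hM
    have : (M : ℂ) ≠ 0 := by exact_mod_cast (show M ≠ 0 by omega)
    field_simp
  have hlim := ((tendsto_x_mul_prod x).mul hM).mul (tendsto_factorial_ratio hi (k := k))
  have hlim2 := hlim.const_mul ((-1 : ℂ) ^ (i + k) / (x + k - i))
  simp only [mul_one] at hlim2
  refine hlim2.congr' ?_
  filter_upwards [Filter.eventually_ge_atTop (2 * k)] with M hM2
  rw [A_window x hk hi hM2 hx]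
  ring

/-- **Zagier 2012, Lemma 1**: for `k ≥ 1` and `x` away from the poles,
`f_k(x) = ∑_{m ≥ k} (-1)^{m-k} (k/m) C(m+x, 2m) C(2m, m-k) = 1 - (sin πx/π) ∑_{j=-k}^{k-1} (-1)^j/(x-j)`
(with `j = i - k`: `(-1)^j/(x - j) = (-1)^{i+k}/(x + k - i)`), as the limit of the partial sums.
[cite: Zagier2012, Lemma 1] -/
theorem zagier_lemma1 {k : ℕ} (hk : 1 ≤ k) (hx : ∀ i : ℕ, i < 2 * k → x + k - i ≠ 0) :
    Tendsto (fun M : ℕ => ∑ m ∈ Finset.Ico k M, t x k m) atTop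
      (𝓝 (1 - Complex.sin (π * x) / π * ∑ i ∈ Finset.range (2 * k), (-1) ^ (i + k) / (x + k - i))) := by
  have hS : Tendsto (fun M : ℕ => S x k M) atTop
      (𝓝 (∑ i ∈ Finset.range (2 * k), (-1) ^ (i + k) / (x + k - i) * (Complex.sin (π * x) / π))) :=
    tendsto_finsetSum _ fun i hi => tendsto_A_window x hk (Finset.mem_range.1 hi) (hx i (Finset.mem_range.1 hi))
  have h := (tendsto_const_nhds (x := (1 : ℂ))).sub hS
  rw [show (1 : ℂ) - ∑ i ∈ Finset.range (2 * k), (-1) ^ (i + k) / (x + k - i) * (Complex.sin (π * x) / π) =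
    1 - Complex.sin (π * x) / π * ∑ i ∈ Finset.range (2 * k), (-1) ^ (i + k) / (x + k - i) by
    rw [Finset.mul_sum]
    congr 1
    exact Finset.sum_congr rfl fun i _ => by ring] at h
  refine h.congr' ?_
  filter_upwards [Filter.eventually_ge_atTop k] with M hM
  exact (sum_t_eq x hk hx hM).symm

end Zagier2012


end Literature.NumberTheory.Transcendental
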